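import Summits.NavierStokesRegularity.NavierStokesRegularity.Theorems.ExtremiserTransienceNearExtremalTransienceExtremiserLiouvilleConstantSpeedLiouville
import HarnessLib

/-!
# Crux `ExtremiserTransience.NearExtremalTransience` (stmt-NavierStokesRegularity-21883), line `extremiser_liouville`,
# stub K1b — L² FLUX LIOUVILLE, part 1/2: the axial × transverse cut-off estimate

`--supports stmt-NavierStokesRegularity-21883` (helper).  Author: prover seat `ns-el-k1b` (g3).

g2's flux Liouville (`…ConstantSpeedLiouville`, radial cut-off) needs `R⁻¹∫_{R≤‖x‖≤2R}‖w − c‖ → 0`, which fails exactly at the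
`|x|⁻²` (rotlet) rate singled out by the far-field analysis of `Lines/extremiser_liouville_k1b_multiplier.md` (item 7).  Testing
`div V = 0` (`V = w − c`, `⟪V, c⟫ = −‖V‖²/2`) instead against `arctan⟪c,x⟫ · k_T(x₃) · χ_ρ(x₁,x₂)` — an AXIAL cut-off of
length `T` times a TRANSVERSE (square) cut-off of width `ρ` — the lateral leak lives in a slab of bounded height, where
Cauchy–Schwarz against the VOLUME `64Tρ²` of the box costs only `‖V‖_{L²(‖x‖≥ρ)}`:
`½∫ k_Tχ_ρ ‖V‖²/(1+⟪c,x⟫²) ≤ (πC/(4|c₃|T))‖V‖₂² + (πC'/2)(δ/2·∫_{‖x‖≥ρ}‖V‖² + 32T/δ)` for every `δ > 0`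
(`integral_axialCutoff_weight_le`).  Letting `ρ → ∞`, then `δ → ∞`, then `T → ∞`:

* `eq_zero_of_constSpeedDeviation_memLp_two_axial` : **if `V ∈ C¹`, `div V = 0`, `⟪V x, c⟫ = −‖V x‖²/2` with `c` along the
  third axis (`c₀ = c₁ = 0 ≠ c₂`), and `V ∈ L²(ℝ³)`, then `V ≡ 0`**;
* `eq_farField_of_constSpeed_of_memLp_two_axial` : **a `C¹` divergence-free field with `‖w‖ ≡ M = ‖c‖`, `c = (0,0,c₂) ≠ 0` and
  `w − c ∈ L²` is the constant `c`.**  (The general direction `c` follows by conjugating with a rotation,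
  `VectorCalculus.IsDivFree.conj_linearIsometryEquiv`; not done here.)

CONSEQUENCE for K1b: the residue object (constant-speed analytic extended extremiser, far field `c`) has **`w − c ∉ L²(ℝ³)`** —
its `L²` excess energy is infinite; in particular the `|x|⁻²` ROTLET tail (which is `L²`) is excluded, and with item 7 of the
record (no `|x|⁻¹` tail, heuristically) no power-law tail survives.

WHAT THIS IS NOT: K1b is NOT proved (the general-direction reduction and, above all, `w − c ∈ L²` for the residue object are
not established); nothing here proves NS regularity. [folklore]
-/

noncomputable section

open Set Filter Topology MeasureTheory Metric Function
open scoped ENNReal NNReal Topology InnerProductSpace RealInnerProductSpace ContDiff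
open Literature.Analysis.FluidPDE Literature.Analysis

namespace Summit.NavierStokesRegularity.NavierStokesRegularity.Theorems

-- the problem directory repeats the summit name (`NavierStokesRegularity/NavierStokesRegularity`)
set_option linter.dupNamespace false

namespace ExtremiserLiouville

variable {V : EuclideanSpace ℝ (Fin 3) → EuclideanSpace ℝ (Fin 3)} {c : EuclideanSpace ℝ (Fin 3)}

/-- **The tested identity with a general cut-off factor** `K ∈ C¹_c`: for `V ∈ C¹` divergence free with
`⟪V x, c⟫ = −‖V x‖²/2`, `½ ∫ K ‖V‖²/(1+⟪c,x⟫²) = ∫ arctan⟪c,x⟫ · DK(x)(V x)` (as g2's `integral_cutoff_weight_eq`). [folklore] -/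
theorem integral_testFactor_weight_eq (hV : ContDiff ℝ 1 V) (hdiv : VectorCalculus.IsDivFree V)
    (hVc : ∀ x, ⟪V x, c⟫ = -(‖V x‖ ^ 2 / 2)) {K : EuclideanSpace ℝ (Fin 3) → ℝ} (hK : ContDiff ℝ 1 K)
    (hKc : HasCompactSupport K) :
    (∫ x, K x * (‖V x‖ ^ 2 / (1 + ⟪c, x⟫ ^ 2))) = 2 * ∫ x, Real.arctan ⟪c, x⟫ * fderiv ℝ K x (V x) := by
  have harc : ContDiff ℝ 1 fun x : EuclideanSpace ℝ (Fin 3) => Real.arctan ⟪c, x⟫ :=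
    Real.contDiff_arctan.comp (contDiff_const.inner ℝ contDiff_id)
  have hθ : ContDiff ℝ 1 fun x => Real.arctan ⟪c, x⟫ * K x := harc.mul hK
  have hθc : HasCompactSupport fun x => Real.arctan ⟪c, x⟫ * K x := hKc.mul_left
  have hibp := integral_mul_divergence_add_eq_zero_left hθ hV hθc
  have hzero : (∫ x, Real.arctan ⟪c, x⟫ * K x * VectorCalculus.divergence V x) = 0 := by simp [hdiv _]
  rw [hzero, zero_add] at hibp
  have hD : ∀ x, ⟪V x, gradient (fun x => Real.arctan ⟪c, x⟫ * K x) x⟫ =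
      Real.arctan ⟪c, x⟫ * fderiv ℝ K x (V x) - K x * (‖V x‖ ^ 2 / (1 + ⟪c, x⟫ ^ 2)) / 2 := by
    intro x
    rw [real_inner_comm, gradient, InnerProductSpace.toDual_symm_apply]
    have h1 : HasFDerivAt (fun x : EuclideanSpace ℝ (Fin 3) => Real.arctan ⟪c, x⟫)
        ((1 / (1 + ⟪c, x⟫ ^ 2)) • innerSL ℝ c) x :=
      (Real.hasDerivAt_arctan ⟪c, x⟫).comp_hasFDerivAt x (innerSL ℝ c).hasFDerivAt
    have h2 : HasFDerivAt K (fderiv ℝ K x) x := ((hK.differentiable one_ne_zero) x).hasFDerivAt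
    have h12 : HasFDerivAt (fun x : EuclideanSpace ℝ (Fin 3) => Real.arctan ⟪c, x⟫ * K x)
        (Real.arctan ⟪c, x⟫ • fderiv ℝ K x + K x • ((1 / (1 + ⟪c, x⟫ ^ 2)) • innerSL ℝ c)) x := h1.mul h2
    rw [h12.fderiv]
    have happ : (Real.arctan ⟪c, x⟫ • fderiv ℝ K x + K x • ((1 / (1 + ⟪c, x⟫ ^ 2)) • innerSL ℝ c)) (V x) =
        Real.arctan ⟪c, x⟫ * fderiv ℝ K x (V x) + K x * ((1 / (1 + ⟪c, x⟫ ^ 2)) * ⟪c, V x⟫) := rfl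
    rw [happ, real_inner_comm (V x) c, hVc x]
    field_simp
    ring
  simp_rw [hD] at hibp
  have hint1 : Integrable (fun x => Real.arctan ⟪c, x⟫ * fderiv ℝ K x (V x)) volume := by
    refine Continuous.integrable_of_hasCompactSupport ?_ ?_
    · exact (Real.continuous_arctan.comp (continuous_const.inner continuous_id)).mul
        ((hK.continuous_fderiv one_ne_zero).clm_apply hV.continuous)
    · exact ((hKc.fderiv (𝕜 := ℝ)).mono fun x hx => by
        contrapose! hx
        simp only [mem_support, not_not] at hx
        simp [hx]).mul_left
  have hint2 : Integrable (fun x => K x * (‖V x‖ ^ 2 / (1 + ⟪c, x⟫ ^ 2)) / 2) volume := by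
    refine Continuous.integrable_of_hasCompactSupport ?_ (hKc.mul_right.mul_right)
    refine (hK.continuous.mul ((hV.continuous.norm.pow 2).div
      (continuous_const.add ((continuous_const.inner continuous_id).pow 2)) fun x => ?_)).div_const _
    have : (0 : ℝ) < 1 + ⟪c, x⟫ ^ 2 := by positivity
    exact this.ne'
  rw [integral_sub hint1 hint2, sub_eq_zero] at hibp
  have h2 : (∫ x, K x * (‖V x‖ ^ 2 / (1 + ⟪c, x⟫ ^ 2)) / 2) = (∫ x, K x * (‖V x‖ ^ 2 / (1 + ⟪c, x⟫ ^ 2))) / 2 :=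
    integral_div _ _
  rw [h2] at hibp
  linarith

/-! ## The axial × transverse cut-off and the main inequality -/

/-- The transverse projection `P x = x − x₂ e₂` (kills the third coordinate), a continuous linear map. -/
theorem exists_transverseProj : ∃ P : EuclideanSpace ℝ (Fin 3) →L[ℝ] EuclideanSpace ℝ (Fin 3),
    ∀ x, P x = x - (x 2) • EuclideanSpace.single (2 : Fin 3) (1 : ℝ) :=
  ⟨ContinuousLinearMap.id ℝ _ - (EuclideanSpace.proj (2 : Fin 3)).smulRight (EuclideanSpace.single (2 : Fin 3) (1 : ℝ)),
    fun _ => rfl⟩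

/-- Coordinates of the transverse projection. [folklore] -/
theorem transverseProj_apply (x : EuclideanSpace ℝ (Fin 3)) :
    (x - (x 2) • EuclideanSpace.single (2 : Fin 3) (1 : ℝ)) 0 = x 0 ∧
      (x - (x 2) • EuclideanSpace.single (2 : Fin 3) (1 : ℝ)) 1 = x 1 ∧
      (x - (x 2) • EuclideanSpace.single (2 : Fin 3) (1 : ℝ)) 2 = 0 := by
  refine ⟨?_, ?_, ?_⟩ <;> simp

/-- `‖x − x₂e₂‖² = x₀² + x₁² ≤ ‖x‖²`, hence `‖P v‖ ≤ ‖v‖` and `‖P x‖ ≤ ‖x‖`. [folklore] -/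
theorem norm_transverseProj_le (x : EuclideanSpace ℝ (Fin 3)) :
    ‖x - (x 2) • EuclideanSpace.single (2 : Fin 3) (1 : ℝ)‖ ≤ ‖x‖ := by
  obtain ⟨h0, h1, h2⟩ := transverseProj_apply x
  have hsq : ‖x - (x 2) • EuclideanSpace.single (2 : Fin 3) (1 : ℝ)‖ ^ 2 ≤ ‖x‖ ^ 2 := by
    rw [EuclideanSpace.real_norm_sq_eq, EuclideanSpace.real_norm_sq_eq, Fin.sum_univ_three, Fin.sum_univ_three, h0, h1, h2]
    nlinarith [sq_nonneg (x 2)]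
  exact (pow_le_pow_iff_left₀ (norm_nonneg _) (norm_nonneg _) two_ne_zero).1 hsq

/-- **Main inequality.**  For `V ∈ C¹` divergence free with `⟪V, c⟫ = −‖V‖²/2`, `c₀ = c₁ = 0 ≠ c₂`, `‖V‖² ∈ L¹`, and all
`T, ρ, δ > 0`: `∫ k_T χ_ρ ‖V‖²/(1+⟪c,x⟫²) ≤ (A/T)∫‖V‖² + B·(δ·∫_{‖x‖≥ρ}‖V‖² + T/δ)` with constants `A, B` depending only on
the cut-off profile and `c₂` (`k_T(x) = cutoff T (x₂)`, `χ_ρ(x) = cutoff ρ (x − x₂e₂)`). [folklore] -/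
theorem integral_axialCutoff_weight_le (hV : ContDiff ℝ 1 V) (hdiv : VectorCalculus.IsDivFree V)
    (hVc : ∀ x, ⟪V x, c⟫ = -(‖V x‖ ^ 2 / 2)) (hc0 : c 0 = 0) (hc1 : c 1 = 0) (hc2 : c 2 ≠ 0)
    (hL2 : Integrable (fun x => ‖V x‖ ^ 2) volume) :
    ∃ A B : ℝ, 0 ≤ A ∧ 0 ≤ B ∧ ∀ T ρ δ : ℝ, 0 < T → 0 < ρ → 0 < δ →
      (∫ x, cutoff T (x 2) * cutoff ρ (x - (x 2) • EuclideanSpace.single (2 : Fin 3) (1 : ℝ)) *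
          (‖V x‖ ^ 2 / (1 + ⟪c, x⟫ ^ 2))) ≤
        A / T * (∫ x, ‖V x‖ ^ 2) +
          B * (δ * (∫ x in {x : EuclideanSpace ℝ (Fin 3) | ρ ≤ ‖x‖}, ‖V x‖ ^ 2) + T / δ) := by
  obtain ⟨C₁, hC₁, hC1⟩ := exists_norm_fderiv_cutoff_le (E := ℝ)
  obtain ⟨C₂, hC₂, hC2⟩ := exists_norm_fderiv_cutoff_le (E := EuclideanSpace ℝ (Fin 3))
  obtain ⟨P, hP⟩ := exists_transverseProj
  refine ⟨Real.pi * C₁ / |c 2|, Real.pi * C₂ * 32, by positivity, by positivity, fun T ρ δ hT hρ hδ => ?_⟩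
  set e₂ : EuclideanSpace ℝ (Fin 3) := EuclideanSpace.single (2 : Fin 3) (1 : ℝ) with he₂
  -- the two cut-offs
  set k : EuclideanSpace ℝ (Fin 3) → ℝ := fun x => cutoff T (x 2) with hkdef
  set χ : EuclideanSpace ℝ (Fin 3) → ℝ := fun x => cutoff ρ (x - (x 2) • e₂) with hχdef
  have hk2 : k = fun x => cutoff T ((EuclideanSpace.proj (2 : Fin 3) : EuclideanSpace ℝ (Fin 3) →L[ℝ] ℝ) x) := rfl
  have hχP : χ = fun x => cutoff ρ (P x) := funext fun x => by rw [hχdef, hP]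
  have hk : ContDiff ℝ 1 k := by
    rw [hk2]; exact (contDiff_cutoff T).comp (EuclideanSpace.proj (2 : Fin 3) : EuclideanSpace ℝ (Fin 3) →L[ℝ] ℝ).contDiff
  have hχ : ContDiff ℝ 1 χ := by rw [hχP]; exact (contDiff_cutoff ρ).comp P.contDiff
  have hK : ContDiff ℝ 1 fun x => k x * χ x := hk.mul hχ
  have hk01 : ∀ x, 0 ≤ k x ∧ k x ≤ 1 := fun x => ⟨cutoff_nonneg _ _, cutoff_le_one _ _⟩
  have hχ01 : ∀ x, 0 ≤ χ x ∧ χ x ≤ 1 := fun x => ⟨cutoff_nonneg _ _, cutoff_le_one _ _⟩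
  have hk0 : ∀ x : EuclideanSpace ℝ (Fin 3), 2 * T < |x 2| → k x = 0 := fun x hx => by
    rw [hkdef]; exact cutoff_eq_zero hT (by rw [Real.norm_eq_abs]; exact hx.le)
  have hχ0 : ∀ x : EuclideanSpace ℝ (Fin 3), 2 * ρ < ‖x - (x 2) • e₂‖ → χ x = 0 := fun x hx => by
    rw [hχdef]; exact cutoff_eq_zero hρ hx.le
  -- the box containing the support of everything
  set BOX : Set (EuclideanSpace ℝ (Fin 3)) := {x | |x 0| ≤ 2 * ρ ∧ |x 1| ≤ 2 * ρ ∧ |x 2| ≤ 2 * T} with hBOX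
  have hPcoord := transverseProj_apply
  have hsuppBOX : ∀ x, k x * χ x ≠ 0 → x ∈ BOX := by
    intro x hx
    have hkx : k x ≠ 0 := left_ne_zero_of_mul hx
    have hχx : χ x ≠ 0 := right_ne_zero_of_mul hx
    have h2 : |x 2| ≤ 2 * T := by by_contra h; exact hkx (hk0 x (not_le.1 h))
    have h01 : ‖x - (x 2) • e₂‖ ≤ 2 * ρ := by by_contra h; exact hχx (hχ0 x (not_le.1 h))
    obtain ⟨q0, q1, -⟩ := hPcoord x
    refine ⟨?_, ?_, h2⟩
    · have := PiLp.norm_apply_le (x - (x 2) • e₂) (0 : Fin 3)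
      rw [Real.norm_eq_abs, q0] at this; exact this.trans h01
    · have := PiLp.norm_apply_le (x - (x 2) • e₂) (1 : Fin 3)
      rw [Real.norm_eq_abs, q1] at this; exact this.trans h01
  have hBOXbdd : BOX ⊆ closedBall (0 : EuclideanSpace ℝ (Fin 3)) (2 * ρ + 2 * ρ + 2 * T) := by
    intro x hx
    rw [mem_closedBall_zero_iff]
    obtain ⟨h0, h1, h2⟩ := hx
    have hsq : ‖x‖ ^ 2 = |x 0| ^ 2 + |x 1| ^ 2 + |x 2| ^ 2 := by
      rw [EuclideanSpace.real_norm_sq_eq, Fin.sum_univ_three, sq_abs, sq_abs, sq_abs]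
    nlinarith [abs_nonneg (x 0), abs_nonneg (x 1), abs_nonneg (x 2), norm_nonneg x, hρ, hT]
  have hKc : HasCompactSupport fun x => k x * χ x :=
    HasCompactSupport.intro (isCompact_closedBall (0 : EuclideanSpace ℝ (Fin 3)) (2 * ρ + 2 * ρ + 2 * T))
      fun x hx => by
        by_contra h
        exact hx (hBOXbdd (hsuppBOX x h))
  -- the tested identity
  have hid := integral_testFactor_weight_eq hV hdiv hVc hK hKc
  -- the derivative of the product along `V`
  have hVx2 : ∀ x, V x 2 = -(‖V x‖ ^ 2 / 2) / c 2 := fun x => by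
    have h := hVc x
    have hinner : ⟪V x, c⟫ = V x 2 * c 2 := by
      simp only [PiLp.inner_apply, RCLike.inner_apply, conj_trivial, Fin.sum_univ_three, hc0, hc1]
      ring
    rw [hinner] at h
    field_simp
    linarith
  have hDk : ∀ x, fderiv ℝ k x (V x) = fderiv ℝ (cutoff (E := ℝ) T) (x 2) (V x 2) := fun x => by
    have h : HasFDerivAt k ((fderiv ℝ (cutoff (E := ℝ) T) (x 2)).comp
        (EuclideanSpace.proj (2 : Fin 3) : EuclideanSpace ℝ (Fin 3) →L[ℝ] ℝ)) x := by
      rw [hk2]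
      exact (((contDiff_cutoff (n := 1) T).differentiable one_ne_zero) _).hasFDerivAt.comp x
        (EuclideanSpace.proj (2 : Fin 3) : EuclideanSpace ℝ (Fin 3) →L[ℝ] ℝ).hasFDerivAt
    rw [h.fderiv]
    rfl
  have hDχ : ∀ x, fderiv ℝ χ x (V x) = fderiv ℝ (cutoff ρ) (P x) (P (V x)) := fun x => by
    have h : HasFDerivAt χ ((fderiv ℝ (cutoff ρ) (P x)).comp P) x := by
      rw [hχP]
      exact (((contDiff_cutoff (n := 1) ρ).differentiable one_ne_zero) _).hasFDerivAt.comp x P.hasFDerivAt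
    rw [h.fderiv]
    rfl
  have hDK : ∀ x, fderiv ℝ (fun x => k x * χ x) x (V x) =
      k x * fderiv ℝ (cutoff ρ) (P x) (P (V x)) + χ x * fderiv ℝ (cutoff (E := ℝ) T) (x 2) (V x 2) := by
    intro x
    have hk' : HasFDerivAt k (fderiv ℝ k x) x := ((hk.differentiable one_ne_zero) x).hasFDerivAt
    have hχ' : HasFDerivAt χ (fderiv ℝ χ x) x := ((hχ.differentiable one_ne_zero) x).hasFDerivAt
    have hm : HasFDerivAt (fun x => k x * χ x) (k x • fderiv ℝ χ x + χ x • fderiv ℝ k x) x := hk'.mul hχ'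
    rw [hm.fderiv]
    show k x • fderiv ℝ χ x (V x) + χ x • fderiv ℝ k x (V x) = _
    rw [smul_eq_mul, smul_eq_mul, hDk, hDχ]
  -- pointwise bound of the integrand `arctan⟪c,x⟫ · DK(x)(V x)`
  set bound : EuclideanSpace ℝ (Fin 3) → ℝ := fun x =>
    (Real.pi / 2 * C₂ * (δ / 2)) * {x : EuclideanSpace ℝ (Fin 3) | ρ ≤ ‖x‖}.indicator (fun x => ‖V x‖ ^ 2) x +
      (Real.pi / 2 * C₂ * (1 / (2 * δ * ρ ^ 2))) * BOX.indicator (fun _ => (1 : ℝ)) x +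
      (Real.pi / 2 * (C₁ / T) / (2 * |c 2|)) * ‖V x‖ ^ 2 with hbound
  have hP_norm : ∀ v : EuclideanSpace ℝ (Fin 3), ‖P v‖ ≤ ‖v‖ := fun v => by rw [hP]; exact norm_transverseProj_le v
  have hptw : ∀ x, ‖Real.arctan ⟪c, x⟫ * fderiv ℝ (fun x => k x * χ x) x (V x)‖ ≤ bound x := by
    intro x
    rw [hDK x, Real.norm_eq_abs, abs_mul]
    have ha : |Real.arctan ⟪c, x⟫| ≤ Real.pi / 2 :=
      abs_le.2 ⟨(Real.neg_pi_div_two_lt_arctan _).le, (Real.arctan_lt_pi_div_two _).le⟩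
    -- term A : axial derivative, quadratic in `V`
    have hA : |χ x * fderiv ℝ (cutoff (E := ℝ) T) (x 2) (V x 2)| ≤ C₁ / T * (‖V x‖ ^ 2 / (2 * |c 2|)) := by
      rw [abs_mul, abs_of_nonneg (hχ01 x).1]
      have h1 : |fderiv ℝ (cutoff (E := ℝ) T) (x 2) (V x 2)| ≤ C₁ / T * |V x 2| := by
        rw [← Real.norm_eq_abs, ← Real.norm_eq_abs (V x 2)]
        exact ((fderiv ℝ (cutoff (E := ℝ) T) (x 2)).le_opNorm _).trans
          (mul_le_mul_of_nonneg_right (hC1 T hT (x 2)) (norm_nonneg _))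
      have h2 : |V x 2| = ‖V x‖ ^ 2 / (2 * |c 2|) := by
        rw [hVx2 x, abs_div, abs_neg, abs_of_nonneg (by positivity : (0 : ℝ) ≤ ‖V x‖ ^ 2 / 2)]
        field_simp
      calc χ x * |fderiv ℝ (cutoff (E := ℝ) T) (x 2) (V x 2)| ≤ 1 * (C₁ / T * |V x 2|) :=
            mul_le_mul (hχ01 x).2 h1 (abs_nonneg _) zero_le_one
        _ = C₁ / T * (‖V x‖ ^ 2 / (2 * |c 2|)) := by rw [one_mul, h2]
    -- term B : transverse derivative, on the annulus-slab, linear in `V`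
    have hB : |k x * fderiv ℝ (cutoff ρ) (P x) (P (V x))| ≤
        C₂ * (δ / 2 * ({x : EuclideanSpace ℝ (Fin 3) | ρ ≤ ‖x‖}.indicator (fun x => ‖V x‖ ^ 2) x) +
          1 / (2 * δ * ρ ^ 2) * BOX.indicator (fun _ => (1 : ℝ)) x) := by
      by_cases hann : ρ ≤ ‖P x‖ ∧ ‖P x‖ ≤ 2 * ρ
      · by_cases hkx : k x = 0
        · rw [hkx, zero_mul, abs_zero]
          exact mul_nonneg hC₂ (add_nonneg (mul_nonneg (by positivity) (indicator_nonneg (fun _ _ => by positivity) _))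
            (mul_nonneg (by positivity) (indicator_nonneg (fun _ _ => zero_le_one) _)))
        · -- `x ∈ BOX` and `‖x‖ ≥ ρ`
          have hxfar : x ∈ {x : EuclideanSpace ℝ (Fin 3) | ρ ≤ ‖x‖} := hann.1.trans (hP_norm x)
          have hxBOX : x ∈ BOX := by
            have h2 : |x 2| ≤ 2 * T := by by_contra h; exact hkx (hk0 x (not_le.1 h))
            obtain ⟨q0, q1, -⟩ := hPcoord x
            have hPx : P x = x - (x 2) • e₂ := hP x
            refine ⟨?_, ?_, h2⟩
            · have := PiLp.norm_apply_le (x - (x 2) • e₂) (0 : Fin 3)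
              rw [Real.norm_eq_abs, q0, ← hPx] at this; exact this.trans hann.2
            · have := PiLp.norm_apply_le (x - (x 2) • e₂) (1 : Fin 3)
              rw [Real.norm_eq_abs, q1, ← hPx] at this; exact this.trans hann.2
          rw [indicator_of_mem hxfar, indicator_of_mem hxBOX, abs_mul, abs_of_nonneg (hk01 x).1]
          have h1 : |fderiv ℝ (cutoff ρ) (P x) (P (V x))| ≤ C₂ / ρ * ‖V x‖ := by
            rw [← Real.norm_eq_abs]
            calc ‖fderiv ℝ (cutoff ρ) (P x) (P (V x))‖ ≤ ‖fderiv ℝ (cutoff ρ) (P x)‖ * ‖P (V x)‖ :=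
                  (fderiv ℝ (cutoff ρ) (P x)).le_opNorm _
              _ ≤ (C₂ / ρ) * ‖V x‖ := mul_le_mul (hC2 ρ hρ (P x)) (hP_norm (V x)) (norm_nonneg _) (by positivity)
          -- AM–GM: `(C₂/ρ)‖V‖ ≤ C₂(δ/2 ‖V‖² + 1/(2δρ²))`
          have hamgm : C₂ / ρ * ‖V x‖ ≤ C₂ * (δ / 2 * ‖V x‖ ^ 2 + 1 / (2 * δ * ρ ^ 2) * 1) := by
            rw [mul_one]
            have hkey : ‖V x‖ / ρ ≤ δ / 2 * ‖V x‖ ^ 2 + 1 / (2 * δ * ρ ^ 2) := by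
              have h := sq_nonneg (δ * ρ * ‖V x‖ - 1)
              have heq : δ / 2 * ‖V x‖ ^ 2 + 1 / (2 * δ * ρ ^ 2) - ‖V x‖ / ρ =
                  (δ * ρ * ‖V x‖ - 1) ^ 2 / (2 * δ * ρ ^ 2) := by
                field_simp
                ring
              have hnn : 0 ≤ (δ * ρ * ‖V x‖ - 1) ^ 2 / (2 * δ * ρ ^ 2) := by positivity
              linarith
            calc C₂ / ρ * ‖V x‖ = C₂ * (‖V x‖ / ρ) := by ring
              _ ≤ C₂ * (δ / 2 * ‖V x‖ ^ 2 + 1 / (2 * δ * ρ ^ 2)) := mul_le_mul_of_nonneg_left hkey hC₂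
          calc k x * |fderiv ℝ (cutoff ρ) (P x) (P (V x))| ≤ 1 * (C₂ / ρ * ‖V x‖) :=
                mul_le_mul (hk01 x).2 h1 (abs_nonneg _) zero_le_one
            _ = C₂ / ρ * ‖V x‖ := one_mul _
            _ ≤ C₂ * (δ / 2 * ‖V x‖ ^ 2 + 1 / (2 * δ * ρ ^ 2) * 1) := hamgm
      · have h0 : fderiv ℝ (cutoff ρ) (P x) (P (V x)) = 0 := by
          rw [fderiv_cutoff_eq_zero_of_notMem hρ hann]; rfl
        rw [h0, mul_zero, abs_zero]
        exact mul_nonneg hC₂ (add_nonneg (mul_nonneg (by positivity) (indicator_nonneg (fun _ _ => by positivity) _))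
          (mul_nonneg (by positivity) (indicator_nonneg (fun _ _ => zero_le_one) _)))
    calc |Real.arctan ⟪c, x⟫| * |k x * fderiv ℝ (cutoff ρ) (P x) (P (V x)) + χ x * fderiv ℝ (cutoff (E := ℝ) T) (x 2) (V x 2)|
        ≤ Real.pi / 2 * (|k x * fderiv ℝ (cutoff ρ) (P x) (P (V x))| + |χ x * fderiv ℝ (cutoff (E := ℝ) T) (x 2) (V x 2)|) :=
          mul_le_mul ha (abs_add_le _ _) (abs_nonneg _) (by positivity)
      _ ≤ Real.pi / 2 * (C₂ * (δ / 2 * ({x : EuclideanSpace ℝ (Fin 3) | ρ ≤ ‖x‖}.indicator (fun x => ‖V x‖ ^ 2) x) +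
          1 / (2 * δ * ρ ^ 2) * BOX.indicator (fun _ => (1 : ℝ)) x) + C₁ / T * (‖V x‖ ^ 2 / (2 * |c 2|))) :=
          mul_le_mul_of_nonneg_left (add_le_add hB hA) (by positivity)
      _ = bound x := by simp only [hbound]; ring
  -- integrability of the bound and its integral
  have hBOXmeas : MeasurableSet BOX := by
    have : BOX = {x | |x 0| ≤ 2 * ρ} ∩ {x | |x 1| ≤ 2 * ρ} ∩ {x | |x 2| ≤ 2 * T} := by
      ext x; simp [hBOX, and_assoc]
    rw [this]
    have hc : ∀ i : Fin 3, Continuous fun x : EuclideanSpace ℝ (Fin 3) => |x i| := fun i =>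
      (continuous_apply i |>.comp (PiLp.continuous_ofLp 2 _)).abs
    exact ((isClosed_le (hc 0) continuous_const).measurableSet.inter (isClosed_le (hc 1) continuous_const).measurableSet).inter
      (isClosed_le (hc 2) continuous_const).measurableSet
  have hBOXfin : volume BOX < ⊤ :=
    (measure_mono hBOXbdd).trans_lt (isCompact_closedBall _ _).measure_lt_top
  have hBOXreal : (volume BOX).toReal = 64 * ρ ^ 2 * T := by
    -- `BOX` is the preimage of a coordinate box under the volume-preserving `ofLp`
    set r : Fin 3 → ℝ := ![2 * ρ, 2 * ρ, 2 * T] with hr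
    have hBOXeq : BOX = (WithLp.ofLp : EuclideanSpace ℝ (Fin 3) → (Fin 3 → ℝ)) ⁻¹' Set.Icc (-r) r := by
      ext x
      simp only [hBOX, mem_setOf_eq, mem_preimage, Set.mem_Icc, Pi.le_def, Pi.neg_apply, abs_le]
      constructor
      · rintro ⟨h0, h1, h2⟩
        refine ⟨fun i => ?_, fun i => ?_⟩ <;> fin_cases i <;> simp [hr] <;> linarith [h0.1, h0.2, h1.1, h1.2, h2.1, h2.2]
      · rintro ⟨hl, hu⟩
        have l0 := hl 0; have l1 := hl 1; have l2 := hl 2; have u0 := hu 0; have u1 := hu 1; have u2 := hu 2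
        simp [hr] at l0 l1 l2 u0 u1 u2
        exact ⟨⟨l0, u0⟩, ⟨l1, u1⟩, ⟨l2, u2⟩⟩
    have hrr : -r ≤ r := fun i => by fin_cases i <;> simp [hr] <;> linarith
    rw [hBOXeq, (PiLp.volume_preserving_ofLp (Fin 3)).measure_preimage measurableSet_Icc.nullMeasurableSet,
      Real.volume_Icc_pi_toReal hrr, Fin.prod_univ_three]
    simp [hr]
    ring
  -- integrability of the bound
  have hfar_meas : MeasurableSet {x : EuclideanSpace ℝ (Fin 3) | ρ ≤ ‖x‖} :=
    (isClosed_le continuous_const continuous_norm).measurableSet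
  have hI1 : Integrable (fun x => {x : EuclideanSpace ℝ (Fin 3) | ρ ≤ ‖x‖}.indicator (fun x => ‖V x‖ ^ 2) x) volume :=
    hL2.indicator hfar_meas
  have hI2 : Integrable (fun x => BOX.indicator (fun _ => (1 : ℝ)) x) volume := by
    rw [integrable_indicator_iff hBOXmeas]
    exact integrableOn_const hBOXfin.ne
  have hbound_int : Integrable bound volume := by
    simp only [hbound]
    exact ((hI1.const_mul _).add (hI2.const_mul _)).add (hL2.const_mul _)
  -- the estimate
  have hmain := norm_integral_le_of_norm_le hbound_int (Eventually.of_forall hptw)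
  have hbound_val : ∫ x, bound x =
      (Real.pi / 2 * C₂ * (δ / 2)) * (∫ x in {x : EuclideanSpace ℝ (Fin 3) | ρ ≤ ‖x‖}, ‖V x‖ ^ 2) +
        (Real.pi / 2 * C₂ * (1 / (2 * δ * ρ ^ 2))) * (64 * ρ ^ 2 * T) +
        (Real.pi / 2 * (C₁ / T) / (2 * |c 2|)) * (∫ x, ‖V x‖ ^ 2) := by
    have hI12 : Integrable (fun x => (Real.pi / 2 * C₂ * (δ / 2)) * {x : EuclideanSpace ℝ (Fin 3) | ρ ≤ ‖x‖}.indicator (fun x => ‖V x‖ ^ 2) x +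
        (Real.pi / 2 * C₂ * (1 / (2 * δ * ρ ^ 2))) * BOX.indicator (fun _ => (1 : ℝ)) x) volume :=
      (hI1.const_mul _).add (hI2.const_mul _)
    have hI3 : Integrable (fun x => (Real.pi / 2 * (C₁ / T) / (2 * |c 2|)) * ‖V x‖ ^ 2) volume := hL2.const_mul _
    have hI1' : Integrable (fun x => (Real.pi / 2 * C₂ * (δ / 2)) * {x : EuclideanSpace ℝ (Fin 3) | ρ ≤ ‖x‖}.indicator (fun x => ‖V x‖ ^ 2) x) volume :=
      hI1.const_mul _
    have hI2' : Integrable (fun x => (Real.pi / 2 * C₂ * (1 / (2 * δ * ρ ^ 2))) * BOX.indicator (fun _ => (1 : ℝ)) x) volume :=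
      hI2.const_mul _
    simp only [hbound]
    rw [integral_add hI12 hI3, integral_add hI1' hI2', integral_const_mul, integral_const_mul, integral_const_mul,
      integral_indicator hfar_meas, integral_indicator hBOXmeas, setIntegral_const, smul_eq_mul, mul_one,
      measureReal_def, hBOXreal]
  have hZ0 : 0 ≤ ∫ x, ‖V x‖ ^ 2 := integral_nonneg fun x => sq_nonneg _
  have hF0 : 0 ≤ ∫ x in {x : EuclideanSpace ℝ (Fin 3) | ρ ≤ ‖x‖}, ‖V x‖ ^ 2 :=
    setIntegral_nonneg hfar_meas fun x _ => sq_nonneg _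
  have habs : (∫ x, Real.arctan ⟪c, x⟫ * fderiv ℝ (fun x => k x * χ x) x (V x)) ≤ ∫ x, bound x :=
    (le_abs_self _).trans (by simpa only [Real.norm_eq_abs] using hmain)
  rw [hbound_val] at habs
  have hc2pos : 0 < |c 2| := abs_pos.2 hc2
  have e1 : (Real.pi / 2 * C₂ * (1 / (2 * δ * ρ ^ 2))) * (64 * ρ ^ 2 * T) = Real.pi * C₂ * 16 * (T / δ) := by
    field_simp
    ring
  rw [e1] at habs
  rw [hid]
  have h2 : (Real.pi / 2 * C₂ * (δ / 2)) * (∫ x in {x : EuclideanSpace ℝ (Fin 3) | ρ ≤ ‖x‖}, ‖V x‖ ^ 2) ≤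
      Real.pi * C₂ * 16 * (δ * ∫ x in {x : EuclideanSpace ℝ (Fin 3) | ρ ≤ ‖x‖}, ‖V x‖ ^ 2) := by
    have : 0 ≤ Real.pi * C₂ * δ * ∫ x in {x : EuclideanSpace ℝ (Fin 3) | ρ ≤ ‖x‖}, ‖V x‖ ^ 2 := by positivity
    nlinarith
  have h3 : 2 * ((Real.pi / 2 * (C₁ / T) / (2 * |c 2|)) * (∫ x, ‖V x‖ ^ 2)) ≤ Real.pi * C₁ / |c 2| / T * (∫ x, ‖V x‖ ^ 2) := by
    have hpi : 0 ≤ Real.pi * C₁ / |c 2| / T * (∫ x, ‖V x‖ ^ 2) := by positivity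
    have heq : 2 * ((Real.pi / 2 * (C₁ / T) / (2 * |c 2|)) * (∫ x, ‖V x‖ ^ 2)) =
        (Real.pi * C₁ / |c 2| / T * (∫ x, ‖V x‖ ^ 2)) / 2 := by
      ring
    rw [heq]
    linarith
  nlinarith [habs, h2, h3, hF0, hZ0, Real.pi_pos, hC₂, hδ.le, hT.le]

end ExtremiserLiouville

end Summit.NavierStokesRegularity.NavierStokesRegularity.Theorems

end
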